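/-
Copyright (c) 2026 the pub-hodgecm-mathlib formalisation cell (harness21).  Prover seat hodgecm-mathlib-K2E3-p04 (g0), Track B ∕ K2-LIT
(build stream 29), h413 = `stmt-HodgeConjecture-24833`, line `K2_E3_EllipticInputs`, unit U4 «Keys» — DEAL (K2E3-plan (g1) BATCH #1, 22:03Z)
`Theorems/K2E3RankOneIntertwiningIntegral.lean`: the rank-one intertwining integral `J(w, χ)` on ★ `cmPrincipalSeries`, RUNG 1 + RUNG 2.  2026-09-03.
-/
import Summits.HodgeConjecture.HodgeConjecture.Theorems.F0P3U3PrincipalSeriesOpenCellTorusChar   -- ★ N1 brick (T-ℓ): `exists_weylElt_three`, `weylScalar_eq`, `exists_openCellSection_three` + its ★ imports (T1 transport, T2 Jacobian, T3b Weyl conjugation, G3-CM compact support, unimodular `N`)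
import Summits.HodgeConjecture.HodgeConjecture.Theorems.F0P2pJacquetConstituentLemmas             -- ★ `twist_trivial_twist_comp_proj_apply` (the scalar by which `B` acts on the inducing line)
import Summits.HodgeConjecture.HodgeConjecture.Theorems.F0P2nBorelCharactersUnipotent              -- ★ `deltaChar_cmBorel_eq_one` (`δ_B|_N = 1`)
import HarnessLib

/-!
# h413 ∕ Track B «K2-LIT», line `K2_E3_EllipticInputs`, unit U4 «Keys»: THE RANK-ONE INTERTWINING INTEGRAL `J(w, χ) : i_G(χ) → i_G(wχ)`
# on `U(Φ₃)(L⁺_v)` — construction as a non-zero `G`-map with the integral formula `(J f)(g) = ∫_N f(w₀ n g) dn`, from the convergence of ONE integral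

Cell `pub/hodgecm-mathlib`, crux H413 = `stmt-HodgeConjecture-24833`, route of record `HCCMUnconditional`; chair K2-lead (g0), dealer K2E3-plan (g1)
(DEALS BATCH #1 2026-09-03T22:03Z: «p04 DEAL `Theorems/K2E3RankOneIntertwiningIntegral.lean` — analytic half of #5's residue: the intertwining integral
`J(w,χ)` on ★ `cmPrincipalSeries χ`, absolute convergence for `χ₁ = η‖·‖_E^s`, `Re s > s₀`, `J(w,χ) ∈ Hom_G(i(χ), i(wχ))` non-zero [BZ1977 ∕ Casselman1995 §6.4 ∕
Keys1984 §3] (XL first half)»).  THEOREMS ONLY (no `def`, no `instance`, no `notation`, no named-fact hypothesis, no `sorry`); lane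
`--supports stmt-HodgeConjecture-24833 --as helper` (count-neutral; consumers: U4-b `sig_K2E3CompZeroKeysListRegular` via K2E3-p05's `K2E3KeysGammaFactor`).

THE MATHEMATICS ([Casselman1995, §6.4 pp. 62–64: «`T_w f(g) = ∫_{N_w} f(w⁻¹ n g) dn` … converges for `χ` in a cone and defines a `G`-morphism
`I(χ) → I(wχ)`»]; [BernsteinZelevinsky1977, Geometrical Lemma 2.12, §5]; [Keys1984, §3 «the intertwining operators `A(w, λ)`»]; [Rogawski1990, §12.2 p. 173]).
`G ⊇ P = M N` a parabolic triple, `w₀ ∈ G` with `w₀ M w₀⁻¹ ⊆ P`, `μ` a right-invariant measure on `N`, `χ, χ'` characters of `M`, `i(χ) = i_P^G ℂ_χ`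
(★ `Representation.normalizedInd`, functions `f(p g) = χ(m_p) δ_P^{1∕2}(p) f(g)`).
* RUNG 1 (§1 `exists_intertwiningIntegral`).  IF every cell function `n ↦ f(w₀ n)` (`f ∈ i(χ)`) is `μ`-integrable, then the Haar functional
  `λ(f) = ∫_N f(w₀ n) dμ(n)` is LINEAR and `(P, χ' δ_P^{1∕2})`-EQUIVARIANT: `N` acts trivially (right invariance of `μ`, ★ `SmoothInd.integral_cellFun_smoothIndRep`)
  and `m ∈ M` acts by `χ(ʷm) δ_P^{1∕2}(ʷm) · κ_m` (★ T1 `SmoothInd.integral_cellFun_smoothIndRep_of_conj`: `n m = m (m⁻¹ n m)`, `μ.map (m⁻¹ · m) = κ_m • μ`),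
  which is `χ'(m) δ_P^{1∕2}(m)` by the hypothesis `hscal` (for the Borel of `U(3)`: `κ_m = δ_B(m)`, `δ_B^{1∕2}(ʷm) = δ_B^{-1∕2}(m)`, `χ(ʷm) = wχ(m)` — ★ `weylScalar_eq`).
  FROBENIUS RECIPROCITY (★ `Representation.frobeniusInv`, [BernsteinZelevinsky1976, Prop. 2.28]) turns `λ` into the `G`-map `J : i(χ) → i(χ')`,
  `(J f)(g) = λ(g · f) = ∫_N f(w₀ n g) dμ(n)` — Casselman's `T_w`.  NO compact-support ∕ integrability is needed for the equivariance (change of variables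
  holds for all a.e.-strongly measurable integrands); integrability enters ONLY through additivity of `λ`.
* RUNG 2 (§1 `integrable_cellFun_of_exists`).  Every section vanishing at `1` has COMPACTLY SUPPORTED cell function (hypothesis `hcs`; for `U(Φ₃)(L⁺_v)` this is
  ★ G3-CM `hasCompactSupport_cellFun_cmPrincipalSeries_three`), so `f ↦ f − (f(1)∕f₀(1)) f₀` reduces the integrability of ALL cell functions to that of ONE
  section `f₀` with `f₀(1) ≠ 0` — the absolute convergence of the single integral `∫_N f₀(w₀ n) dn` (for the `K_v`-spherical `f₀`: Casselman's
  `c`-function integral `∫_N |χ δ^{1∕2}|(a(w₀ n)) dn`, convergent for `Re s > s₀` — RUNG 3, not in this file).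
* §1 `intertwiningIntegral_ne_zero`: `J ≠ 0` as soon as some section has INDICATOR cell function `1_K` with `0 < μ(K) < ∞` (`(J Φ)(1) = μ(K)`).
* §2 the CM dress **`exists_intertwiningIntegral_cmPrincipalSeries`**: `G = U(Φ₃)(L⁺_v)`, `v` NON-SPLIT, `χ = (χ₁, χ₂)` continuous, `w₀` of matrix `Φ₃`
  (★ `exists_weylElt_three`), `μ` ANY Haar measure of `N(L⁺_v)` (unimodular ★): from ONE `f₀ ∈ i_G(χ)` with `f₀(1) ≠ 0` and integrable cell function,
  **`∃ J : i_G(χ₁, χ₂) →_G i_G(χ̄₁⁻¹, χ₂)`, `J ≠ 0`, `(J f)(g) = ∫_N f(w₀ n g) dμ(n)` for all `f, g`** (★ `weylScalar_eq` ∕ ★ T2 ∕ ★ T3b supply `hscal`,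
  ★ G3-CM supplies `hcs`, ★ `exists_openCellSection_three` the indicator section).

WHAT IS NOT HERE (honest).  RUNG 3 = the CONVERGENCE `∫_N |f₀(w₀ n)| dn < ∞` for `χ₁ = η‖·‖_E^s`, `Re s > s₀` (Iwasawa `A`-part of `w₀ u(x, z)` on the
Heisenberg group, [Keys1984, §3]; [Casselman1995, §6.4]) — the hypothesis `hint₀` of §2; and the composition formula `J(w⁻¹, wχ) J(w, χ) = γ(χ) · id`
(K2E3-p05's `K2E3KeysGammaFactor`).  For REGULAR `χ` a non-zero `G`-map `i(χ) → i(wχ)` exists unconditionally and algebraically (★ K5c step 1);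
the point of this file is the INTEGRAL FORMULA, which is what the `γ`-factor computation consumes.

HONEST LABEL.  HC_CM is proved only modulo the 7 printed citations (2 remaining named inputs: hLiu418 = `stmt-HodgeConjecture-24832`, h413 =
`stmt-HodgeConjecture-24833`) until rung 0 closes; this file moves no counter.

## References
* [Casselman1995] W. Casselman, *Introduction to the theory of admissible representations of `p`-adic reductive groups* (draft 1 May 1995), §3.2
  Thm. 3.2.4 (Frobenius) p. 34, §6.3, §6.4 pp. 62–64 (the operators `T_w`, convergence in a cone, `G`-morphism `I(χ) → I(wχ)`), Thm. 6.6.2 p. 66.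
* [BernsteinZelevinsky1977] I. N. Bernstein, A. V. Zelevinsky, *Induced representations of reductive `p`-adic groups I*, Ann. Sci. ÉNS 10 (1977),
  Prop. 1.9 (b), §2.3, Geometrical Lemma 2.12, §5.
* [BernsteinZelevinsky1976] I. N. Bernstein, A. V. Zelevinsky, Russian Math. Surveys 31:3 (1976), Prop. 2.28 (Frobenius reciprocity), §1.7.
* [Keys1984] D. Keys, *Principal series representations of special unitary groups over local fields*, Compositio Math. 51 (1984), §3 (the operators
  `A(w, λ)`), §5, §7.
* [Rogawski1990] J. D. Rogawski, *Automorphic Representations of Unitary Groups in Three Variables*, Ann. of Math. Stud. 123 (1990), §1.10 p. 9, §12.2 p. 173.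
-/

set_option autoImplicit false
-- the mandated namespace repeats the single-problem summit's segment (`HodgeConjecture.HodgeConjecture`)
set_option linter.dupNamespace false

noncomputable section

open NumberField IsDedekindDomain MeasureTheory
open scoped Matrix NNReal ENNReal

open Literature.NumberTheory Literature.NumberTheory.Automorphic Literature.NumberTheory.Automorphic.UnitaryGroup

namespace Summit.HodgeConjecture.HodgeConjecture.Cruxes.H413.K2E3RankOneIntertwiningIntegral

universe u

/-! ## §1 Generic: the intertwining integral of a parabolic triple with a two-sided cell, from integrable cell functions -/

section Generic

variable {G : Type u} [Group G] [TopologicalSpace G] [IsTopologicalGroup G] (t : ParabolicTriple G) [LocallyCompactSpace ↥t.P]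
  [MeasurableSpace ↥t.N] [BorelSpace ↥t.N] (μ : Measure ↥t.N) (w₀ : G) (χ χ' : ↥t.M →* ℂˣ)

/-- **RUNG 2 — integrability of ALL cell functions from ONE.**  If every section of `i(χ)` vanishing at `1` has compactly supported cell function
`n ↦ f(w₀ n)` (hypothesis `hcs`), and ONE section `f₀` with `f₀(1) ≠ 0` has `μ`-integrable cell function, then every cell function is `μ`-integrable:
`f − (f(1)∕f₀(1)) • f₀` vanishes at `1`, its cell function is continuous (locally constant, ★ `SmoothInd.continuous_cellFun`) with compact support, hence
integrable (★ `SmoothInd.integrable_cellFun`), and `cell(f) = cell(f − a • f₀) + a • cell(f₀)`. [cite: Casselman1995, §6.4 p. 63; §6.3] [cite: BernsteinZelevinsky1977, §5] -/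
theorem integrable_cellFun_of_exists [IsFiniteMeasureOnCompacts μ]
    (hcs : ∀ f : Representation.SmoothInd t.P
        (Representation.twist (((Representation.trivial ℂ ↥t.M ℂ).twist χ).comp t.proj) (rootDeltaChar t.P)),
      f.toFun 1 = 0 → HasCompactSupport fun n : ↥t.N => f.toFun (w₀ * (n : G)))
    (f₀ : Representation.SmoothInd t.P (Representation.twist (((Representation.trivial ℂ ↥t.M ℂ).twist χ).comp t.proj) (rootDeltaChar t.P)))
    (hf₀ : f₀.toFun 1 ≠ 0) (hint₀ : Integrable (fun n : ↥t.N => f₀.toFun (w₀ * (n : G))) μ)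
    (f : Representation.SmoothInd t.P (Representation.twist (((Representation.trivial ℂ ↥t.M ℂ).twist χ).comp t.proj) (rootDeltaChar t.P))) :
    Integrable (fun n : ↥t.N => f.toFun (w₀ * (n : G))) μ := by
  set a : ℂ := f.toFun 1 / f₀.toFun 1 with ha
  -- the section `f - a • f₀` vanishes at `1`
  have h0 : (f - a • f₀).toFun 1 = 0 := by
    have e : (f - a • f₀).toFun = f.toFun - a • f₀.toFun := rfl
    rw [e, Pi.sub_apply, Pi.smul_apply, smul_eq_mul, ha, div_mul_cancel₀ _ hf₀, sub_self]
  have hint₁ : Integrable (fun n : ↥t.N => (f - a • f₀).toFun (w₀ * (n : G))) μ :=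
    SmoothInd.integrable_cellFun t.P _ t.N.subtype w₀ μ continuous_subtype_val (hcs _ h0)
  have e : (fun n : ↥t.N => f.toFun (w₀ * (n : G))) =
      fun n : ↥t.N => (f - a • f₀).toFun (w₀ * (n : G)) + a • f₀.toFun (w₀ * (n : G)) := by
    funext n
    have e' : (f - a • f₀).toFun = f.toFun - a • f₀.toFun := rfl
    rw [e', Pi.sub_apply, Pi.smul_apply, sub_add_cancel]
  rw [e]
  exact hint₁.add (hint₀.smul a)

/-- **RUNG 1 — THE INTERTWINING INTEGRAL `J : i(χ) → i(χ')`, `(J f)(g) = ∫_N f(w₀ n g) dμ(n)`.**  Data: `t = (P, M, N)`, `w₀ ∈ G` with `w₀ m w₀⁻¹ ∈ P` for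
`m ∈ M` (`hconj`), for every `m ∈ M` a measurable `c_m : N → N` with `n m = m c_m(n)` and `μ.map c_m = κ_m • μ` (`hc`, `hκ`; for a Borel: `c_m = Ad(m⁻¹)`,
`κ_m = δ_P(m)`), `δ_P|_N = 1` (`hδ`), the SCALAR IDENTITY `δ_P^{1∕2}(ʷm) χ(proj ʷm) κ_m = δ_P^{1∕2}(m) χ'(m)` (`hscal`), and `μ`-integrability of every cell
function of `i(χ)` (`hint`).  Then the Haar functional `λ(f) = ∫_N f(w₀ n) dμ` is a `(P, χ' δ_P^{1∕2})`-equivariant linear form on `i(χ)` (`N`: right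
invariance ★ `SmoothInd.integral_cellFun_smoothIndRep`; `M`: ★ T1 `SmoothInd.integral_cellFun_smoothIndRep_of_conj` + `hscal`; a general `p = m n`,
`m = proj p`, ★ `ParabolicTriple.proj_inv_mul_mem`), and FROBENIUS (★ `Representation.frobeniusInv`) yields the `G`-map `J` with `(J f)(g) = λ(g · f)`.
[cite: Casselman1995, §6.4 pp. 62–64; Thm. 3.2.4 p. 34] [cite: BernsteinZelevinsky1977, Geometrical Lemma 2.12, §5 (5.2), Prop. 1.9 (b)]
[cite: BernsteinZelevinsky1976, Prop. 2.28] [cite: Keys1984, §3] -/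
theorem exists_intertwiningIntegral [μ.IsMulRightInvariant]
    (hconj : ∀ m : ↥t.M, w₀ * (m : G) * w₀⁻¹ ∈ t.P)
    (c : ↥t.M → ↥t.N → ↥t.N) (hcm : ∀ m, Measurable (c m))
    (hc : ∀ (m : ↥t.M) (n : ↥t.N), (n : G) * (m : G) = (m : G) * (c m n : G))
    (κ : ↥t.M → ℝ≥0) (hκ : ∀ m, μ.map (c m) = κ m • μ)
    (hδ : ∀ (n : G) (hn : n ∈ t.N), deltaChar t.P ⟨n, t.N_le hn⟩ = 1)
    (hscal : ∀ m : ↥t.M,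
      ((rootDeltaChar t.P ⟨w₀ * (m : G) * w₀⁻¹, hconj m⟩ : ℂˣ) : ℂ) * ((χ (t.proj ⟨w₀ * (m : G) * w₀⁻¹, hconj m⟩) : ℂˣ) : ℂ) * (κ m : ℂ) =
        ((rootDeltaChar t.P (Subgroup.inclusion t.M_le m) : ℂˣ) : ℂ) * ((χ' m : ℂˣ) : ℂ))
    (hint : ∀ f : Representation.SmoothInd t.P
        (Representation.twist (((Representation.trivial ℂ ↥t.M ℂ).twist χ).comp t.proj) (rootDeltaChar t.P)),
      Integrable (fun n : ↥t.N => f.toFun (w₀ * (n : G))) μ) :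
    ∃ J : (Representation.normalizedInd t ((Representation.trivial ℂ ↥t.M ℂ).twist χ)).IntertwiningMap
        (Representation.normalizedInd t ((Representation.trivial ℂ ↥t.M ℂ).twist χ')),
      ∀ (f : Representation.SmoothInd t.P
          (Representation.twist (((Representation.trivial ℂ ↥t.M ℂ).twist χ).comp t.proj) (rootDeltaChar t.P))) (g : G),
        (J f).toFun g = ∫ n : ↥t.N, f.toFun (w₀ * (n : G) * g) ∂μ := by
  have hsm : (Representation.normalizedInd t ((Representation.trivial ℂ ↥t.M ℂ).twist χ)).IsSmooth :=
    Representation.isSmooth_smoothInd t.P _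
  -- the Haar functional `λ(f) = ∫_N f(w₀ n) dμ`
  let lam : Representation.SmoothInd t.P
      (Representation.twist (((Representation.trivial ℂ ↥t.M ℂ).twist χ).comp t.proj) (rootDeltaChar t.P)) →ₗ[ℂ] ℂ :=
    { toFun := fun f => ∫ n : ↥t.N, f.toFun (w₀ * (n : G)) ∂μ
      map_add' := fun f g => by
        change ∫ n : ↥t.N, (f + g).toFun (w₀ * (n : G)) ∂μ = (∫ n : ↥t.N, f.toFun (w₀ * (n : G)) ∂μ) + ∫ n : ↥t.N, g.toFun (w₀ * (n : G)) ∂μ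
        rw [← integral_add (hint f) (hint g)]
        rfl
      map_smul' := fun a f => by
        change ∫ n : ↥t.N, (a • f).toFun (w₀ * (n : G)) ∂μ = a • ∫ n : ↥t.N, f.toFun (w₀ * (n : G)) ∂μ
        rw [← integral_smul]
        rfl }
  have hlam : ∀ f, lam f = ∫ n : ↥t.N, f.toFun (w₀ * (n : G)) ∂μ := fun f => rfl
  -- `N` acts trivially on `λ`
  have hN : ∀ (n₀ : ↥t.N) (f : Representation.SmoothInd t.P
      (Representation.twist (((Representation.trivial ℂ ↥t.M ℂ).twist χ).comp t.proj) (rootDeltaChar t.P))),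
      lam (Representation.normalizedInd t ((Representation.trivial ℂ ↥t.M ℂ).twist χ) (n₀ : G) f) = lam f :=
    fun n₀ f => SmoothInd.integral_cellFun_smoothIndRep t.P _ t.N.subtype w₀ μ n₀ f
  -- `M` acts on `λ` by `δ^{1/2}(ʷm) χ(proj ʷm) κ_m = δ^{1/2}(m) χ'(m)`
  have hM : ∀ (m : ↥t.M) (f : Representation.SmoothInd t.P
      (Representation.twist (((Representation.trivial ℂ ↥t.M ℂ).twist χ).comp t.proj) (rootDeltaChar t.P))),
      lam (Representation.normalizedInd t ((Representation.trivial ℂ ↥t.M ℂ).twist χ) (m : G) f) =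
        (((rootDeltaChar t.P (Subgroup.inclusion t.M_le m) : ℂˣ) : ℂ) * ((χ' m : ℂˣ) : ℂ)) * lam f := by
    intro m f
    have hs : ∀ z : ℂ, Representation.twist (((Representation.trivial ℂ ↥t.M ℂ).twist χ).comp t.proj) (rootDeltaChar t.P)
        ⟨w₀ * (m : G) * w₀⁻¹, hconj m⟩ z =
          (((rootDeltaChar t.P ⟨w₀ * (m : G) * w₀⁻¹, hconj m⟩ : ℂˣ) : ℂ) * ((χ (t.proj ⟨w₀ * (m : G) * w₀⁻¹, hconj m⟩) : ℂˣ) : ℂ)) • z :=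
      fun z => by rw [F0P2pJacquetConstituentLemmas.twist_trivial_twist_comp_proj_apply, smul_eq_mul]
    have h : ∫ n : ↥t.N, ((Representation.normalizedInd t ((Representation.trivial ℂ ↥t.M ℂ).twist χ)) (m : G) f).toFun (w₀ * (n : G)) ∂μ =
        ((((rootDeltaChar t.P ⟨w₀ * (m : G) * w₀⁻¹, hconj m⟩ : ℂˣ) : ℂ) * ((χ (t.proj ⟨w₀ * (m : G) * w₀⁻¹, hconj m⟩) : ℂˣ) : ℂ)) * (κ m : ℂ)) •
          ∫ n : ↥t.N, f.toFun (w₀ * (n : G)) ∂μ :=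
      SmoothInd.integral_cellFun_smoothIndRep_of_conj t.P
        (Representation.twist (((Representation.trivial ℂ ↥t.M ℂ).twist χ).comp t.proj) (rootDeltaChar t.P)) t.N.subtype w₀ μ
        continuous_subtype_val (m : G) (hconj m) (c m) (hcm m) (fun n => hc m n) (hκ m) hs f
    rw [hlam, hlam, h, smul_eq_mul, ← hscal m]
  -- `λ` is `(P, χ' δ^{1/2})`-equivariant
  have hP : ∀ (p : ↥t.P) (f : Representation.SmoothInd t.P
      (Representation.twist (((Representation.trivial ℂ ↥t.M ℂ).twist χ).comp t.proj) (rootDeltaChar t.P))),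
      lam (Representation.normalizedInd t ((Representation.trivial ℂ ↥t.M ℂ).twist χ) (p : G) f) =
        Representation.twist (((Representation.trivial ℂ ↥t.M ℂ).twist χ').comp t.proj) (rootDeltaChar t.P) p (lam f) := by
    intro p f
    -- `p = m n₀`, `m = proj p`, `n₀ = m⁻¹ p ∈ N`
    have hn₀ := t.proj_inv_mul_mem p
    set n₀ : ↥t.N := ⟨((t.proj p : ↥t.M) : G)⁻¹ * (p : G), hn₀⟩ with hn₀def
    have hp : (p : G) = ((t.proj p : ↥t.M) : G) * (n₀ : G) := by rw [hn₀def]; exact (mul_inv_cancel_left _ _).symm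
    have hp' : p = Subgroup.inclusion t.M_le (t.proj p) * ⟨(n₀ : G), t.N_le hn₀⟩ := Subtype.ext hp
    have hδ' : rootDeltaChar t.P ⟨(n₀ : G), t.N_le hn₀⟩ = 1 := rootDeltaChar_eq_one_of_deltaChar_eq_one t.P (hδ _ hn₀)
    have hr : rootDeltaChar t.P p = rootDeltaChar t.P (Subgroup.inclusion t.M_le (t.proj p)) := by
      conv_lhs => rw [hp']
      rw [map_mul, hδ', mul_one]
    rw [F0P2pJacquetConstituentLemmas.twist_trivial_twist_comp_proj_apply, hr, hp, map_mul, Module.End.mul_apply, hM, hN]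
  -- Frobenius reciprocity
  let φ : Representation.IntertwiningMap ((Representation.normalizedInd t ((Representation.trivial ℂ ↥t.M ℂ).twist χ)).comp t.P.subtype)
      (Representation.twist (((Representation.trivial ℂ ↥t.M ℂ).twist χ').comp t.proj) (rootDeltaChar t.P)) :=
    { toLinearMap := lam
      isIntertwining' := fun p => LinearMap.ext fun f => hP p f }
  -- `(J f)(g) = λ(g · f) = ∫ (g · f)(w₀ n) dμ = ∫ f(w₀ n g) dμ`, all definitional (★ `toFun_frobeniusInv_apply`, ★ `toFun_smoothIndRep_apply`)
  exact ⟨Representation.frobeniusInv hsm φ, fun f g => rfl⟩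

omit [BorelSpace ↥t.N] in
/-- **`J ≠ 0`**: if some section `Φ` of `i(χ)` has INDICATOR cell function `n ↦ Φ(w₀ n) = 1_K(n)` with `K` measurable, `0 < μ(K) < ∞`, then any `J` with the
integral formula has `(J Φ)(1) = μ(K) ≠ 0` (Mathlib `integral_indicator_const`). [cite: Casselman1995, §6.3, §6.4 p. 63] [cite: BernsteinZelevinsky1977, §5 (5.1)] -/
theorem intertwiningIntegral_ne_zero
    (J : (Representation.normalizedInd t ((Representation.trivial ℂ ↥t.M ℂ).twist χ)).IntertwiningMap
        (Representation.normalizedInd t ((Representation.trivial ℂ ↥t.M ℂ).twist χ')))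
    (hJ : ∀ (f : Representation.SmoothInd t.P
          (Representation.twist (((Representation.trivial ℂ ↥t.M ℂ).twist χ).comp t.proj) (rootDeltaChar t.P))) (g : G),
        (J f).toFun g = ∫ n : ↥t.N, f.toFun (w₀ * (n : G) * g) ∂μ)
    (Φ : Representation.SmoothInd t.P (Representation.twist (((Representation.trivial ℂ ↥t.M ℂ).twist χ).comp t.proj) (rootDeltaChar t.P)))
    {K : Set ↥t.N} (hKm : MeasurableSet K) (hK0 : μ K ≠ 0) (hKtop : μ K ≠ ∞)
    (hΦ : ∀ n : ↥t.N, Φ.toFun (w₀ * (n : G)) = K.indicator (fun _ => (1 : ℂ)) n) : J ≠ 0 := by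
  intro h0
  have h1 : (J Φ).toFun 1 = (μ.real K : ℂ) := by
    rw [hJ]
    simp_rw [mul_one, hΦ]
    rw [integral_indicator_const _ hKm, Complex.real_smul, mul_one]
  have h2 : (J Φ).toFun 1 = 0 := by rw [h0]; rfl
  rw [h2] at h1
  exact (ENNReal.toReal_ne_zero.2 ⟨hK0, hKtop⟩) (by exact_mod_cast h1.symm)

end Generic

/-! ## §2 The CM dress: `G = U(Φ₃)(L⁺_v)`, `v` non-split, `χ = (χ₁, χ₂)` continuous, `w₀` of matrix `Φ₃`, `μ` a Haar measure of `N(L⁺_v)` -/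

section CM

variable (L : Type) [Field L] [NumberField L] [IsCMField L]

set_option synthInstance.maxHeartbeats 400000 in
set_option maxHeartbeats 8000000 in
-- statement∕proof-heavy: the `SmoothInd` carriers of the two `cmPrincipalSeries` (unfolded ONCE to ★ `normalizedInd` by `dsimp only`) + ★ `weylScalar_eq` (class of ★ `F0P3U3PrincipalSeriesOpenCellTorusChar`)
/-- **THE INTERTWINING INTEGRAL `J(w, χ) : i_G(χ₁, χ₂) → i_G(χ̄₁⁻¹, χ₂)` ON `U(Φ₃)(L⁺_v)` FROM ONE CONVERGENT INTEGRAL.**  At a NON-SPLIT finite place `v` of `L⁺`,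
for continuous `χ₁, χ₂`, the Weyl element `w₀ ∈ G` of matrix `Φ₃` (★ `exists_weylElt_three`) and ANY Haar measure `μ` of `N(L⁺_v)`: if ONE section `f₀ ∈ i_G(χ)` with
`f₀(1) ≠ 0` has `μ`-integrable cell function `n ↦ f₀(w₀ n)`, then there is a NON-ZERO `G`-map `J : i_G(χ₁, χ₂) → i_G(χ̄₁⁻¹, χ₂)` (★ `cmPrincipalSeries`, `wχ`
spelled ★ `cmTorusCharPair L v (conjInvChar σ χ₁) χ₂`) with **`(J f)(g) = ∫_N f(w₀ n g) dμ(n)`** for every `f ∈ i_G(χ)`, `g ∈ G`.  §1 at the Borel triple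
★ `cmBorelTriple L 3 v`: `hcs` = ★ G3-CM `hasCompactSupport_cellFun_cmPrincipalSeries_three`; `c_m = Ad(m⁻¹)` = ★ `HeisRing.torusConj`, `κ_m = Δ_B(m)` = ★ T2
`map_torusConj_cmBorel_eq_modularCharacter_nnreal_smul`; `δ_B|_N = 1` = ★ `deltaChar_cmBorel_eq_one`; `hscal` = ★ `weylScalar_eq` with ★ T3b `proj_cmBorel_weylConj` ∕
`cmTorusCharPair_weylConj` (`χ(ʷm) = wχ(m)`, `δ^{1∕2}(ʷm) Δ_B(m) = δ^{1∕2}(m)`); `μ` right invariant = ★ `isMulRightInvariant_cmBorelTriple_N`; `J ≠ 0` at the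
standard open-cell section of ★ `exists_openCellSection_three` (indicator cell function, `0 < μ(K) < ∞`).  This is Casselman's `T_w ∈ Hom_G(I(χ), I(wχ))`
[Casselman1995, §6.4] = Keys' `A(w, λ)` [Keys1984, §3], CONDITIONAL only on the convergence of the single integral `∫_N f₀(w₀ n) dn` (RUNG 3).
[cite: Casselman1995, §6.4 pp. 62–64; Thm. 3.2.4 p. 34] [cite: Keys1984, §3] [cite: BernsteinZelevinsky1977, Geometrical Lemma 2.12, §5] [cite: Rogawski1990, §12.2 p. 173] -/
theorem exists_intertwiningIntegral_cmPrincipalSeries (v : HeightOneSpectrum (𝓞 ↥(maximalRealSubfield L)))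
    (hv : ∀ w : PlacesOver L v, IsCMField.complexConj L • w.1 = w.1)
    (χ₁ : (LocalRing L v)ˣ →* ℂˣ) (χ₂ : ↥(normOneUnits (conjLocal L (IsCMField.complexConj L) v)) →* ℂˣ)
    (h₁ : Continuous fun x => ((χ₁ x : ℂˣ) : ℂ)) (h₂ : Continuous fun x => ((χ₂ x : ℂˣ) : ℂ))
    (w₀ : ↥(unitaryGroupOfForm (conjLocal L (IsCMField.complexConj L) v) (cmLocalForm L 3 v)))
    (hw₀ : Units.val (w₀ : GL (Fin 3) (LocalRing L v)) = cmLocalForm L 3 v)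
    [MeasurableSpace ↥(cmBorelTriple L 3 v).N] [BorelSpace ↥(cmBorelTriple L 3 v).N]
    (μ : Measure ↥(cmBorelTriple L 3 v).N) [μ.IsHaarMeasure]
    (f₀ : haveI := locallyCompactSpace_cmBorelU L 3 v
      Representation.SmoothInd (cmBorelTriple L 3 v).P
        (Representation.twist
          (((Representation.trivial ℂ ↥(torusU (conjLocal L (IsCMField.complexConj L) v) (cmLocalForm L 3 v)) ℂ).twist
            (cmTorusCharPair L v χ₁ χ₂)).comp (cmBorelTriple L 3 v).proj) (rootDeltaChar (cmBorelTriple L 3 v).P)))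
    (hf₀ : f₀.toFun 1 ≠ 0)
    (hint₀ : Integrable (fun n : ↥(cmBorelTriple L 3 v).N =>
      f₀.toFun (w₀ * (n : ↥(unitaryGroupOfForm (conjLocal L (IsCMField.complexConj L) v) (cmLocalForm L 3 v))))) μ) :
    ∃ J : (cmPrincipalSeries L 3 v (cmTorusCharPair L v χ₁ χ₂)).IntertwiningMap
        (cmPrincipalSeries L 3 v (cmTorusCharPair L v (conjInvChar (conjLocal L (IsCMField.complexConj L) v) χ₁) χ₂)),
      J ≠ 0 ∧
      ∀ (f : haveI := locallyCompactSpace_cmBorelU L 3 v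
          Representation.SmoothInd (cmBorelTriple L 3 v).P
            (Representation.twist
              (((Representation.trivial ℂ ↥(torusU (conjLocal L (IsCMField.complexConj L) v) (cmLocalForm L 3 v)) ℂ).twist
                (cmTorusCharPair L v χ₁ χ₂)).comp (cmBorelTriple L 3 v).proj) (rootDeltaChar (cmBorelTriple L 3 v).P)))
        (g : ↥(unitaryGroupOfForm (conjLocal L (IsCMField.complexConj L) v) (cmLocalForm L 3 v))),
        (J f).toFun g = ∫ n : ↥(cmBorelTriple L 3 v).N,
          f.toFun (w₀ * (n : ↥(unitaryGroupOfForm (conjLocal L (IsCMField.complexConj L) v) (cmLocalForm L 3 v))) * g) ∂μ := by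
  haveI := locallyCompactSpace_cmBorelU L 3 v
  haveI : LocallyCompactSpace ↥(unitaryGroupOfForm (conjLocal L (IsCMField.complexConj L) v) (cmLocalForm L 3 v)) :=
    locallyCompactSpace_local (IsCMField.complexConj L) 3 _ v
  haveI : SecondCountableTopology ↥(unitaryGroupOfForm (conjLocal L (IsCMField.complexConj L) v) (cmLocalForm L 3 v)) :=
    secondCountableTopology_local (IsCMField.complexConj L) 3 _ v
  have hNcl : IsClosed ((cmBorelTriple L 3 v).N : Set ↥(unitaryGroupOfForm (conjLocal L (IsCMField.complexConj L) v) (cmLocalForm L 3 v))) :=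
    (isClosed_upperUnitriangular (n := 3) (R := LocalRing L v)).preimage continuous_subtype_val
  haveI : LocallyCompactSpace ↥(cmBorelTriple L 3 v).N := hNcl.isClosedEmbedding_subtypeVal.locallyCompactSpace
  haveI : SecondCountableTopology ↥(cmBorelTriple L 3 v).N := TopologicalSpace.Subtype.secondCountableTopology _
  haveI : μ.IsMulRightInvariant := isMulRightInvariant_cmBorelTriple_N L 3 v μ
  -- ★ `cmPrincipalSeries` ∕ ★ `principalSeries` IS ★ `normalizedInd` (definitional; unfolded once so that §1 applies syntactically)
  dsimp only [UnitaryGroup.cmPrincipalSeries, UnitaryGroup.principalSeries]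
  -- RUNG 2: every cell function is integrable (★ G3-CM compact support of the cell functions of sections vanishing at `1`)
  have hint := integrable_cellFun_of_exists (cmBorelTriple L 3 v) μ w₀ (cmTorusCharPair L v χ₁ χ₂)
    (hasCompactSupport_cellFun_cmPrincipalSeries_three L v hv (cmTorusCharPair L v χ₁ χ₂) w₀ hw₀) f₀ hf₀ hint₀
  -- the torus data `n m = m (m⁻¹ n m)`
  have hc : ∀ (m : ↥(cmBorelTriple L 3 v).M) (n : ↥(cmBorelTriple L 3 v).N),
      (n : ↥(unitaryGroupOfForm (conjLocal L (IsCMField.complexConj L) v) (cmLocalForm L 3 v))) *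
          (m : ↥(unitaryGroupOfForm (conjLocal L (IsCMField.complexConj L) v) (cmLocalForm L 3 v))) =
        (m : ↥(unitaryGroupOfForm (conjLocal L (IsCMField.complexConj L) v) (cmLocalForm L 3 v))) *
          (HeisRing.torusConj (conjLocal L (IsCMField.complexConj L) v) m n :
            ↥(unitaryGroupOfForm (conjLocal L (IsCMField.complexConj L) v) (cmLocalForm L 3 v))) := by
    intro m n
    rw [HeisRing.coe_torusConj, ← mul_assoc, ← mul_assoc, mul_inv_cancel, one_mul]
  -- RUNG 1
  obtain ⟨J, hJ⟩ := exists_intertwiningIntegral (cmBorelTriple L 3 v) μ w₀ (cmTorusCharPair L v χ₁ χ₂)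
    (cmTorusCharPair L v (conjInvChar (conjLocal L (IsCMField.complexConj L) v) χ₁) χ₂) (weylConj_mem_cmBorel L v w₀ hw₀)
    (fun m => HeisRing.torusConj (conjLocal L (IsCMField.complexConj L) v) m)
    (fun m => (HeisRing.continuous_torusConj (conjLocal L (IsCMField.complexConj L) v) m).measurable) hc
    (fun m => (Measure.modularCharacter (⟨(m : ↥(unitaryGroupOfForm (conjLocal L (IsCMField.complexConj L) v) (cmLocalForm L 3 v))), torusU_le_borelU _ _ m.2⟩ :
      ↥(cmBorelTriple L 3 v).P) : ℝ≥0))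
    (fun m => map_torusConj_cmBorel_eq_modularCharacter_nnreal_smul L v m μ)
    (F0P2nBorelCharactersUnipotent.deltaChar_cmBorel_eq_one L v)
    (fun m => by
      -- `δ^{1/2}(ʷm) · χ(ʷm) · Δ_B(m) = δ^{1/2}(m) · wχ(m)`: ★ T3b + ★ `weylScalar_eq`
      rw [proj_cmBorel_weylConj L v w₀ hw₀ m, cmTorusCharPair_weylConj L v w₀ hw₀ χ₁ χ₂ m, ← cmWeylTorusCharPair_eq]
      have h := F0P3U3PrincipalSeriesOpenCellTorusChar.weylScalar_eq L v w₀ hw₀ χ₁ χ₂ m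
      rw [Units.val_inv_eq_inv_val] at h
      exact (inv_mul_eq_iff_eq_mul₀ (Units.ne_zero _)).1 h)
    hint
  -- `J ≠ 0` at the standard open-cell section
  obtain ⟨Φ, -, K, hKo, hKc, hKn, hΦ⟩ := F0P3U3PrincipalSeriesOpenCellTorusChar.exists_openCellSection_three L v w₀ hw₀ χ₁ χ₂ h₁ h₂
  exact ⟨J, intertwiningIntegral_ne_zero (cmBorelTriple L 3 v) μ w₀ _ _ J hJ Φ hKo.measurableSet (hKo.measure_ne_zero μ hKn)
    hKc.measure_lt_top.ne hΦ, hJ⟩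

end CM

end Summit.HodgeConjecture.HodgeConjecture.Cruxes.H413.K2E3RankOneIntertwiningIntegral

end
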